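import Summits.Ventures.PercRepro.C025ProfileTwoFlatPLDMoves

/-!
# PER-LAYER DOMINANCE ON TWO UNIFORM FLATS — INJECTIVITY, SAME FLAT (night-3 g27)

`proofs/NIGHT3-G27-PLD.md` §4.  The injectivity pairs of the two-flat injection in which both images are built on the same
overflowing flat, or an N-image meets an S-image: `N_ne_S₁` / `N_ne_S₂` (an N-image equal to an S-image of a source `τ`
exhibits the N-source as the crossed pair `C τ`, so `τ` is blocked), `S₁_eq_S₁` / `S₂_eq_S₂` and `L₁_eq_L₁` / `L₂_eq_L₂`
(decode the overflowing flat directly and the partner through the injectivity of the absorber on its level).  Sources are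
destructured into their four parts and the common `D`-parts substituted.  No `def`, no `instance`, no notation.
Axioms: standard.
-/

namespace PercRepro

namespace TwoFlatPLD

open Finset

variable {α β : Type} [DecidableEq α] [DecidableEq β]

/-- **N vs S₁**: if the N-image of `σ` is the S₁-image of `τ` (overflowing on flat 1), then `σ` is the crossed pair
`C₁ τ`, a non-overflowing residual source — `τ` is blocked. -/
theorem N_ne_S₁ (F₁ : Finset α) (F₂ : Finset β) (s₁ s₂ : ℕ) (J₁ : Finset α → Finset α) (J₂ : Finset β → Finset β)
    (hJ₁ : ∀ X, J₁ X ⊆ X) (hJ₂ : ∀ X, J₂ X ⊆ X) (lo hi δ : ℕ)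
    (RS : Finset ((Finset α × Finset α) × (Finset β × Finset β)))
    (hRS : ∀ σ : (Finset α × Finset α) × (Finset β × Finset β), σ ∈ RS ↔ σ.1.1 ⊆ F₁ ∧ σ.2.1 ⊆ F₂ ∧
      σ.1.2 ⊆ J₁ (F₁ \ σ.1.1) ∧ σ.2.2 ⊆ J₂ (F₂ \ σ.2.1) ∧
      σ.1.2.card + σ.2.2.card = δ ∧ lo ≤ min σ.1.1.card s₁ + min σ.2.1.card s₂ ∧
      min σ.1.1.card s₁ + min σ.2.1.card s₂ ≤ hi ∧
      hi + δ + 1 ≤ min (F₁.card - σ.1.1.card) s₁ + min (F₂.card - σ.2.1.card) s₂)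
    (φ₂ : Finset β → ℕ → ℕ → Finset β → Finset β)
    (hφ₂ : ∀ (S : Finset β) (i j : ℕ), i ≤ j → i + j ≤ S.card →
      (Set.InjOn (φ₂ S i j) (S.powersetCard i) ∧ ∀ I ∈ S.powersetCard i, φ₂ S i j I ∈ S.powersetCard j ∧ I ⊆ φ₂ S i j I))
    (σ τ : (Finset α × Finset α) × (Finset β × Finset β)) (hσ : σ ∈ RS) (hτ : τ ∈ RS)
    (s1 : ¬ (s₁ < min σ.1.1.card s₁ + σ.1.2.card)) (s2 : ¬ (s₂ < min σ.2.1.card s₂ + σ.2.2.card)) (t1 : s₁ < min τ.1.1.card s₁ + τ.1.2.card) (tb : ¬ ((((F₁ \ τ.1.1) \ τ.1.2, τ.1.2), (φ₂ (F₂ \ τ.2.2) τ.2.1.card (τ.2.1.card + (min τ.1.1.card s₁ + τ.1.2.card - min (F₁.card - τ.1.1.card) s₁)) τ.2.1, τ.2.2)) ∈ RS ∧ ¬ (s₁ < min ((F₁ \ τ.1.1) \ τ.1.2).card s₁ + τ.1.2.card) ∧ ¬ (s₂ < min (φ₂ (F₂ \ τ.2.2) τ.2.1.card (τ.2.1.card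 + (min τ.1.1.card s₁ + τ.1.2.card - min (F₁.card - τ.1.1.card) s₁)) τ.2.1).card s₂ + τ.2.2.card)))
    (h : (((F₁ \ σ.1.1) \ σ.1.2, σ.1.2), ((F₂ \ σ.2.1) \ σ.2.2, σ.2.2)) = ((τ.1.1, τ.1.2), ((F₂ \ (φ₂ (F₂ \ τ.2.2) τ.2.1.card (τ.2.1.card + (min τ.1.1.card s₁ + τ.1.2.card - min (F₁.card - τ.1.1.card) s₁)) τ.2.1)) \ τ.2.2, τ.2.2))) : False := by
  obtain ⟨y1, y2, y3, -, -⟩ := absorb_S₁ F₁ F₂ s₁ s₂ J₁ J₂ hJ₂ lo hi δ RS hRS φ₂ hφ₂ τ hτ t1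
  obtain ⟨⟨I₁, D₁⟩, ⟨I₂, D₂⟩⟩ := σ
  obtain ⟨⟨I₁', D₁'⟩, ⟨I₂', D₂'⟩⟩ := τ
  simp only [Prod.mk.injEq] at h
  obtain ⟨⟨e1, e2⟩, ⟨e3, e4⟩⟩ := h
  subst e2; subst e4
  obtain ⟨sI₁, sI₂, sD₁, sD₂, sδ, slo, shi, sf⟩ := (hRS _).1 hσ
  obtain ⟨tI₁, tI₂, tD₁, tD₂, tδ, tlo, thi, tf⟩ := (hRS _).1 hτ
  dsimp only at sI₁ sI₂ sD₁ sD₂ sδ slo shi sf tI₁ tI₂ tD₁ tD₂ tδ tlo thi tf s1 t1 e1 e3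
  dsimp only at s2 y1 y2 y3 tb
  have hYF : φ₂ (F₂ \ D₂) I₂'.card (I₂'.card + (min I₁'.card s₁ + D₁.card - min (F₁.card - I₁'.card) s₁)) I₂' ⊆ F₂ := y1.trans sdiff_subset
  have hDY : D₂ ⊆ F₂ \ φ₂ (F₂ \ D₂) I₂'.card (I₂'.card + (min I₁'.card s₁ + D₁.card - min (F₁.card - I₁'.card) s₁)) I₂' := by
    intro d hd
    rw [mem_sdiff]
    exact ⟨(mem_sdiff.1 (sD₂.trans (hJ₂ _) hd)).1, fun hdY => (mem_sdiff.1 (y1 hdY)).2 hd⟩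
  have f2 : I₂ = φ₂ (F₂ \ D₂) I₂'.card (I₂'.card + (min I₁'.card s₁ + D₁.card - min (F₁.card - I₁'.card) s₁)) I₂' := eq_of_sdiff_sdiff_eq sI₂ hYF (sD₂.trans (hJ₂ _)) hDY e3
  have f1 : (F₁ \ I₁') \ D₁ = I₁ := sdiff_sdiff_of_eq sI₁ (sD₁.trans (hJ₁ _)) e1.symm
  apply tb
  rw [f1, ← f2]
  exact ⟨hσ, s1, s2⟩

/-- **N vs S₂**, symmetric to `N_ne_S₁`. -/
theorem N_ne_S₂ (F₁ : Finset α) (F₂ : Finset β) (s₁ s₂ : ℕ) (J₁ : Finset α → Finset α) (J₂ : Finset β → Finset β)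
    (hJ₁ : ∀ X, J₁ X ⊆ X) (hJ₂ : ∀ X, J₂ X ⊆ X) (lo hi δ : ℕ)
    (RS : Finset ((Finset α × Finset α) × (Finset β × Finset β)))
    (hRS : ∀ σ : (Finset α × Finset α) × (Finset β × Finset β), σ ∈ RS ↔ σ.1.1 ⊆ F₁ ∧ σ.2.1 ⊆ F₂ ∧
      σ.1.2 ⊆ J₁ (F₁ \ σ.1.1) ∧ σ.2.2 ⊆ J₂ (F₂ \ σ.2.1) ∧
      σ.1.2.card + σ.2.2.card = δ ∧ lo ≤ min σ.1.1.card s₁ + min σ.2.1.card s₂ ∧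
      min σ.1.1.card s₁ + min σ.2.1.card s₂ ≤ hi ∧
      hi + δ + 1 ≤ min (F₁.card - σ.1.1.card) s₁ + min (F₂.card - σ.2.1.card) s₂)
    (φ₁ : Finset α → ℕ → ℕ → Finset α → Finset α)
    (hφ₁ : ∀ (S : Finset α) (i j : ℕ), i ≤ j → i + j ≤ S.card →
      (Set.InjOn (φ₁ S i j) (S.powersetCard i) ∧ ∀ I ∈ S.powersetCard i, φ₁ S i j I ∈ S.powersetCard j ∧ I ⊆ φ₁ S i j I))
    (σ τ : (Finset α × Finset α) × (Finset β × Finset β)) (hσ : σ ∈ RS) (hτ : τ ∈ RS)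
    (s1 : ¬ (s₁ < min σ.1.1.card s₁ + σ.1.2.card)) (s2 : ¬ (s₂ < min σ.2.1.card s₂ + σ.2.2.card)) (t2 : s₂ < min τ.2.1.card s₂ + τ.2.2.card) (tb : ¬ (((φ₁ (F₁ \ τ.1.2) τ.1.1.card (τ.1.1.card + (min τ.2.1.card s₂ + τ.2.2.card - min (F₂.card - τ.2.1.card) s₂)) τ.1.1, τ.1.2), ((F₂ \ τ.2.1) \ τ.2.2, τ.2.2)) ∈ RS ∧ ¬ (s₁ < min (φ₁ (F₁ \ τ.1.2) τ.1.1.card (τ.1.1.card + (min τ.2.1.card s₂ + τ.2.2.card - min (F₂.card - τ.2.1.card) s₂)) τ.1.1).card s₁ + τ.1.2.card) ∧ ¬ (s₂ < min ((F₂ \ τ.2.1) \ τ.2.2).card s₂ + τ.2.2.card)))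
    (h : (((F₁ \ σ.1.1) \ σ.1.2, σ.1.2), ((F₂ \ σ.2.1) \ σ.2.2, σ.2.2)) = (((F₁ \ (φ₁ (F₁ \ τ.1.2) τ.1.1.card (τ.1.1.card + (min τ.2.1.card s₂ + τ.2.2.card - min (F₂.card - τ.2.1.card) s₂)) τ.1.1)) \ τ.1.2, τ.1.2), (τ.2.1, τ.2.2))) : False := by
  obtain ⟨y1, y2, y3, -, -⟩ := absorb_S₂ F₁ F₂ s₁ s₂ J₁ J₂ hJ₁ lo hi δ RS hRS φ₁ hφ₁ τ hτ t2
  obtain ⟨⟨I₁, D₁⟩, ⟨I₂, D₂⟩⟩ := σ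
  obtain ⟨⟨I₁', D₁'⟩, ⟨I₂', D₂'⟩⟩ := τ
  simp only [Prod.mk.injEq] at h
  obtain ⟨⟨e1, e2⟩, ⟨e3, e4⟩⟩ := h
  subst e2; subst e4
  obtain ⟨sI₁, sI₂, sD₁, sD₂, sδ, slo, shi, sf⟩ := (hRS _).1 hσ
  obtain ⟨tI₁, tI₂, tD₁, tD₂, tδ, tlo, thi, tf⟩ := (hRS _).1 hτ
  dsimp only at sI₁ sI₂ sD₁ sD₂ sδ slo shi sf tI₁ tI₂ tD₁ tD₂ tδ tlo thi tf s1 s2 t2 e1 e3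
  dsimp only at y1 y2 y3 tb
  have hYF : φ₁ (F₁ \ D₁) I₁'.card (I₁'.card + (min I₂'.card s₂ + D₂.card - min (F₂.card - I₂'.card) s₂)) I₁' ⊆ F₁ := y1.trans sdiff_subset
  have hDY : D₁ ⊆ F₁ \ φ₁ (F₁ \ D₁) I₁'.card (I₁'.card + (min I₂'.card s₂ + D₂.card - min (F₂.card - I₂'.card) s₂)) I₁' := by
    intro d hd
    rw [mem_sdiff]
    exact ⟨(mem_sdiff.1 (sD₁.trans (hJ₁ _) hd)).1, fun hdY => (mem_sdiff.1 (y1 hdY)).2 hd⟩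
  have f1 : I₁ = φ₁ (F₁ \ D₁) I₁'.card (I₁'.card + (min I₂'.card s₂ + D₂.card - min (F₂.card - I₂'.card) s₂)) I₁' := eq_of_sdiff_sdiff_eq sI₁ hYF (sD₁.trans (hJ₁ _)) hDY e1
  have f2 : (F₂ \ I₂') \ D₂ = I₂ := sdiff_sdiff_of_eq sI₂ (sD₂.trans (hJ₂ _)) e3.symm
  apply tb
  rw [f2, ← f1]
  exact ⟨hσ, s1, s2⟩

/-- **S₁ vs S₁**: equal S-images on flat 1 come from equal sources (the overflowing flat decodes
directly, the partner through the injectivity of the absorber on its level). -/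
theorem S₁_eq_S₁ (F₁ : Finset α) (F₂ : Finset β) (s₁ s₂ : ℕ) (J₁ : Finset α → Finset α) (J₂ : Finset β → Finset β)
    (hJ₂ : ∀ X, J₂ X ⊆ X) (lo hi δ : ℕ)
    (RS : Finset ((Finset α × Finset α) × (Finset β × Finset β)))
    (hRS : ∀ σ : (Finset α × Finset α) × (Finset β × Finset β), σ ∈ RS ↔ σ.1.1 ⊆ F₁ ∧ σ.2.1 ⊆ F₂ ∧
      σ.1.2 ⊆ J₁ (F₁ \ σ.1.1) ∧ σ.2.2 ⊆ J₂ (F₂ \ σ.2.1) ∧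
      σ.1.2.card + σ.2.2.card = δ ∧ lo ≤ min σ.1.1.card s₁ + min σ.2.1.card s₂ ∧
      min σ.1.1.card s₁ + min σ.2.1.card s₂ ≤ hi ∧
      hi + δ + 1 ≤ min (F₁.card - σ.1.1.card) s₁ + min (F₂.card - σ.2.1.card) s₂)
    (φ₂ : Finset β → ℕ → ℕ → Finset β → Finset β)
    (hφ₂ : ∀ (S : Finset β) (i j : ℕ), i ≤ j → i + j ≤ S.card →
      (Set.InjOn (φ₂ S i j) (S.powersetCard i) ∧ ∀ I ∈ S.powersetCard i, φ₂ S i j I ∈ S.powersetCard j ∧ I ⊆ φ₂ S i j I))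
    (σ τ : (Finset α × Finset α) × (Finset β × Finset β)) (hσ : σ ∈ RS) (hτ : τ ∈ RS)
    (s1 : s₁ < min σ.1.1.card s₁ + σ.1.2.card) (t1 : s₁ < min τ.1.1.card s₁ + τ.1.2.card) (h : ((σ.1.1, σ.1.2), ((F₂ \ (φ₂ (F₂ \ σ.2.2) σ.2.1.card (σ.2.1.card + (min σ.1.1.card s₁ + σ.1.2.card - min (F₁.card - σ.1.1.card) s₁)) σ.2.1)) \ σ.2.2, σ.2.2)) = ((τ.1.1, τ.1.2), ((F₂ \ (φ₂ (F₂ \ τ.2.2) τ.2.1.card (τ.2.1.card + (min τ.1.1.card s₁ + τ.1.2.card - min (F₁.card - τ.1.1.card) s₁)) τ.2.1)) \ τ.2.2, τ.2.2))) : σ = τ := by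
  obtain ⟨y1, y2, y3, hall, mem⟩ := absorb_S₁ F₁ F₂ s₁ s₂ J₁ J₂ hJ₂ lo hi δ RS hRS φ₂ hφ₂ σ hσ s1
  obtain ⟨z1, z2, z3, -, mem'⟩ := absorb_S₁ F₁ F₂ s₁ s₂ J₁ J₂ hJ₂ lo hi δ RS hRS φ₂ hφ₂ τ hτ t1
  obtain ⟨⟨I₁, D₁⟩, ⟨I₂, D₂⟩⟩ := σ
  obtain ⟨⟨I₁', D₁'⟩, ⟨I₂', D₂'⟩⟩ := τ
  simp only [Prod.mk.injEq] at h
  obtain ⟨⟨e1, e2⟩, ⟨e3, e4⟩⟩ := h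
  subst e2; subst e4
  obtain ⟨sI₁, sI₂, sD₁, sD₂, sδ, slo, shi, sf⟩ := (hRS _).1 hσ
  obtain ⟨tI₁, tI₂, tD₁, tD₂, tδ, tlo, thi, tf⟩ := (hRS _).1 hτ
  dsimp only at sI₁ sI₂ sD₁ sD₂ sδ slo shi sf tI₁ tI₂ tD₁ tD₂ tδ tlo thi tf s1 t1 e1 e3
  dsimp only at y1 y2 y3 hall mem z1 z2 z3 mem'
  -- flat 1 decodes directly
  have f1 : I₁ = I₁' := e1
  subst f1
  have hDY : D₂ ⊆ F₂ \ φ₂ (F₂ \ D₂) I₂.card (I₂.card + (min I₁.card s₁ + D₁.card - min (F₁.card - I₁.card) s₁)) I₂ := by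
    intro d hd
    rw [mem_sdiff]
    exact ⟨(mem_sdiff.1 (sD₂.trans (hJ₂ _) hd)).1, fun hdY => (mem_sdiff.1 (y1 hdY)).2 hd⟩
  have hDY' : D₂ ⊆ F₂ \ φ₂ (F₂ \ D₂) I₂'.card (I₂'.card + (min I₁.card s₁ + D₁.card - min (F₁.card - I₁.card) s₁)) I₂' := by
    intro d hd
    rw [mem_sdiff]
    exact ⟨(mem_sdiff.1 (sD₂.trans (hJ₂ _) hd)).1, fun hdY => (mem_sdiff.1 (z1 hdY)).2 hd⟩
  have hYeq : φ₂ (F₂ \ D₂) I₂.card (I₂.card + (min I₁.card s₁ + D₁.card - min (F₁.card - I₁.card) s₁)) I₂ = φ₂ (F₂ \ D₂) I₂'.card (I₂'.card + (min I₁.card s₁ + D₁.card - min (F₁.card - I₁.card) s₁)) I₂' :=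
    eq_of_sdiff_sdiff_eq (y1.trans sdiff_subset) (z1.trans sdiff_subset) hDY hDY' e3
  have hlev : I₂'.card = I₂.card := by
    have := congrArg Finset.card hYeq
    rw [y2, z2] at this
    omega
  rw [hlev] at hYeq mem'
  have hH := hφ₂ (F₂ \ D₂) I₂.card (I₂.card + (min I₁.card s₁ + D₁.card - min (F₁.card - I₁.card) s₁)) (by omega) hall
  have fp : I₂ = I₂' := hH.1 (mem_coe.2 mem) (mem_coe.2 mem') hYeq
  rw [fp]

/-- **S₂ vs S₂**: equal S-images on flat 2 come from equal sources (the overflowing flat decodes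
directly, the partner through the injectivity of the absorber on its level). -/
theorem S₂_eq_S₂ (F₁ : Finset α) (F₂ : Finset β) (s₁ s₂ : ℕ) (J₁ : Finset α → Finset α) (J₂ : Finset β → Finset β)
    (hJ₁ : ∀ X, J₁ X ⊆ X) (lo hi δ : ℕ)
    (RS : Finset ((Finset α × Finset α) × (Finset β × Finset β)))
    (hRS : ∀ σ : (Finset α × Finset α) × (Finset β × Finset β), σ ∈ RS ↔ σ.1.1 ⊆ F₁ ∧ σ.2.1 ⊆ F₂ ∧
      σ.1.2 ⊆ J₁ (F₁ \ σ.1.1) ∧ σ.2.2 ⊆ J₂ (F₂ \ σ.2.1) ∧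
      σ.1.2.card + σ.2.2.card = δ ∧ lo ≤ min σ.1.1.card s₁ + min σ.2.1.card s₂ ∧
      min σ.1.1.card s₁ + min σ.2.1.card s₂ ≤ hi ∧
      hi + δ + 1 ≤ min (F₁.card - σ.1.1.card) s₁ + min (F₂.card - σ.2.1.card) s₂)
    (φ₁ : Finset α → ℕ → ℕ → Finset α → Finset α)
    (hφ₁ : ∀ (S : Finset α) (i j : ℕ), i ≤ j → i + j ≤ S.card →
      (Set.InjOn (φ₁ S i j) (S.powersetCard i) ∧ ∀ I ∈ S.powersetCard i, φ₁ S i j I ∈ S.powersetCard j ∧ I ⊆ φ₁ S i j I))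
    (σ τ : (Finset α × Finset α) × (Finset β × Finset β)) (hσ : σ ∈ RS) (hτ : τ ∈ RS)
    (s1 : s₂ < min σ.2.1.card s₂ + σ.2.2.card) (t1 : s₂ < min τ.2.1.card s₂ + τ.2.2.card) (h : (((F₁ \ (φ₁ (F₁ \ σ.1.2) σ.1.1.card (σ.1.1.card + (min σ.2.1.card s₂ + σ.2.2.card - min (F₂.card - σ.2.1.card) s₂)) σ.1.1)) \ σ.1.2, σ.1.2), (σ.2.1, σ.2.2)) = (((F₁ \ (φ₁ (F₁ \ τ.1.2) τ.1.1.card (τ.1.1.card + (min τ.2.1.card s₂ + τ.2.2.card - min (F₂.card - τ.2.1.card) s₂)) τ.1.1)) \ τ.1.2, τ.1.2), (τ.2.1, τ.2.2))) : σ = τ := by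
  obtain ⟨y1, y2, y3, hall, mem⟩ := absorb_S₂ F₁ F₂ s₁ s₂ J₁ J₂ hJ₁ lo hi δ RS hRS φ₁ hφ₁ σ hσ s1
  obtain ⟨z1, z2, z3, -, mem'⟩ := absorb_S₂ F₁ F₂ s₁ s₂ J₁ J₂ hJ₁ lo hi δ RS hRS φ₁ hφ₁ τ hτ t1
  obtain ⟨⟨I₁, D₁⟩, ⟨I₂, D₂⟩⟩ := σ
  obtain ⟨⟨I₁', D₁'⟩, ⟨I₂', D₂'⟩⟩ := τ
  simp only [Prod.mk.injEq] at h
  obtain ⟨⟨e1, e2⟩, ⟨e3, e4⟩⟩ := h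
  subst e2; subst e4
  obtain ⟨sI₁, sI₂, sD₁, sD₂, sδ, slo, shi, sf⟩ := (hRS _).1 hσ
  obtain ⟨tI₁, tI₂, tD₁, tD₂, tδ, tlo, thi, tf⟩ := (hRS _).1 hτ
  dsimp only at sI₁ sI₂ sD₁ sD₂ sδ slo shi sf tI₁ tI₂ tD₁ tD₂ tδ tlo thi tf s1 t1 e1 e3
  dsimp only at y1 y2 y3 hall mem z1 z2 z3 mem'
  -- flat 2 decodes directly
  have f2 : I₂ = I₂' := e3
  subst f2
  have hDY : D₁ ⊆ F₁ \ φ₁ (F₁ \ D₁) I₁.card (I₁.card + (min I₂.card s₂ + D₂.card - min (F₂.card - I₂.card) s₂)) I₁ := by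
    intro d hd
    rw [mem_sdiff]
    exact ⟨(mem_sdiff.1 (sD₁.trans (hJ₁ _) hd)).1, fun hdY => (mem_sdiff.1 (y1 hdY)).2 hd⟩
  have hDY' : D₁ ⊆ F₁ \ φ₁ (F₁ \ D₁) I₁'.card (I₁'.card + (min I₂.card s₂ + D₂.card - min (F₂.card - I₂.card) s₂)) I₁' := by
    intro d hd
    rw [mem_sdiff]
    exact ⟨(mem_sdiff.1 (sD₁.trans (hJ₁ _) hd)).1, fun hdY => (mem_sdiff.1 (z1 hdY)).2 hd⟩
  have hYeq : φ₁ (F₁ \ D₁) I₁.card (I₁.card + (min I₂.card s₂ + D₂.card - min (F₂.card - I₂.card) s₂)) I₁ = φ₁ (F₁ \ D₁) I₁'.card (I₁'.card + (min I₂.card s₂ + D₂.card - min (F₂.card - I₂.card) s₂)) I₁' :=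
    eq_of_sdiff_sdiff_eq (y1.trans sdiff_subset) (z1.trans sdiff_subset) hDY hDY' e1
  have hlev : I₁'.card = I₁.card := by
    have := congrArg Finset.card hYeq
    rw [y2, z2] at this
    omega
  rw [hlev] at hYeq mem'
  have hH := hφ₁ (F₁ \ D₁) I₁.card (I₁.card + (min I₂.card s₂ + D₂.card - min (F₂.card - I₂.card) s₂)) (by omega) hall
  have fp : I₁ = I₁' := hH.1 (mem_coe.2 mem) (mem_coe.2 mem') hYeq
  rw [fp]

/-- **L₁ vs L₁**: equal L-images on flat 1 come from equal sources (the overflowing flat decodes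
directly, the partner through the injectivity of the absorber on its level). -/
theorem L₁_eq_L₁ (F₁ : Finset α) (F₂ : Finset β) (s₁ s₂ : ℕ) (J₁ : Finset α → Finset α) (J₂ : Finset β → Finset β)
    (hJ₁ : ∀ X, J₁ X ⊆ X) (hJ₂ : ∀ X, J₂ X ⊆ X) (lo hi δ : ℕ)
    (RS : Finset ((Finset α × Finset α) × (Finset β × Finset β)))
    (hRS : ∀ σ : (Finset α × Finset α) × (Finset β × Finset β), σ ∈ RS ↔ σ.1.1 ⊆ F₁ ∧ σ.2.1 ⊆ F₂ ∧
      σ.1.2 ⊆ J₁ (F₁ \ σ.1.1) ∧ σ.2.2 ⊆ J₂ (F₂ \ σ.2.1) ∧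
      σ.1.2.card + σ.2.2.card = δ ∧ lo ≤ min σ.1.1.card s₁ + min σ.2.1.card s₂ ∧
      min σ.1.1.card s₁ + min σ.2.1.card s₂ ≤ hi ∧
      hi + δ + 1 ≤ min (F₁.card - σ.1.1.card) s₁ + min (F₂.card - σ.2.1.card) s₂)
    (φ₂ : Finset β → ℕ → ℕ → Finset β → Finset β)
    (hφ₂ : ∀ (S : Finset β) (i j : ℕ), i ≤ j → i + j ≤ S.card →
      (Set.InjOn (φ₂ S i j) (S.powersetCard i) ∧ ∀ I ∈ S.powersetCard i, φ₂ S i j I ∈ S.powersetCard j ∧ I ⊆ φ₂ S i j I))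
    (σ τ : (Finset α × Finset α) × (Finset β × Finset β)) (hσ : σ ∈ RS) (hτ : τ ∈ RS)
    (s1 : s₁ < min σ.1.1.card s₁ + σ.1.2.card) (t1 : s₁ < min τ.1.1.card s₁ + τ.1.2.card) (h : (((F₁ \ σ.1.1) \ σ.1.2, σ.1.2), ((F₂ \ (φ₂ (F₂ \ σ.2.2) σ.2.1.card (σ.2.1.card + (min σ.1.1.card s₁ + σ.1.2.card - s₁)) σ.2.1)) \ σ.2.2, σ.2.2)) = (((F₁ \ τ.1.1) \ τ.1.2, τ.1.2), ((F₂ \ (φ₂ (F₂ \ τ.2.2) τ.2.1.card (τ.2.1.card + (min τ.1.1.card s₁ + τ.1.2.card - s₁)) τ.2.1)) \ τ.2.2, τ.2.2))) : σ = τ := by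
  obtain ⟨y1, y2, y3, hall, mem⟩ := absorb_L₁ F₁ F₂ s₁ s₂ J₁ J₂ hJ₂ lo hi δ RS hRS φ₂ hφ₂ σ hσ s1
  obtain ⟨z1, z2, z3, -, mem'⟩ := absorb_L₁ F₁ F₂ s₁ s₂ J₁ J₂ hJ₂ lo hi δ RS hRS φ₂ hφ₂ τ hτ t1
  obtain ⟨⟨I₁, D₁⟩, ⟨I₂, D₂⟩⟩ := σ
  obtain ⟨⟨I₁', D₁'⟩, ⟨I₂', D₂'⟩⟩ := τ
  simp only [Prod.mk.injEq] at h
  obtain ⟨⟨e1, e2⟩, ⟨e3, e4⟩⟩ := h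
  subst e2; subst e4
  obtain ⟨sI₁, sI₂, sD₁, sD₂, sδ, slo, shi, sf⟩ := (hRS _).1 hσ
  obtain ⟨tI₁, tI₂, tD₁, tD₂, tδ, tlo, thi, tf⟩ := (hRS _).1 hτ
  dsimp only at sI₁ sI₂ sD₁ sD₂ sδ slo shi sf tI₁ tI₂ tD₁ tD₂ tδ tlo thi tf s1 t1 e1 e3
  dsimp only at y1 y2 y3 hall mem z1 z2 z3 mem'
  -- flat 1 decodes directly
  have f1 : I₁ = I₁' := eq_of_sdiff_sdiff_eq sI₁ tI₁ (sD₁.trans (hJ₁ _)) (tD₁.trans (hJ₁ _)) e1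
  subst f1
  have hDY : D₂ ⊆ F₂ \ φ₂ (F₂ \ D₂) I₂.card (I₂.card + (min I₁.card s₁ + D₁.card - s₁)) I₂ := by
    intro d hd
    rw [mem_sdiff]
    exact ⟨(mem_sdiff.1 (sD₂.trans (hJ₂ _) hd)).1, fun hdY => (mem_sdiff.1 (y1 hdY)).2 hd⟩
  have hDY' : D₂ ⊆ F₂ \ φ₂ (F₂ \ D₂) I₂'.card (I₂'.card + (min I₁.card s₁ + D₁.card - s₁)) I₂' := by
    intro d hd
    rw [mem_sdiff]
    exact ⟨(mem_sdiff.1 (sD₂.trans (hJ₂ _) hd)).1, fun hdY => (mem_sdiff.1 (z1 hdY)).2 hd⟩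
  have hYeq : φ₂ (F₂ \ D₂) I₂.card (I₂.card + (min I₁.card s₁ + D₁.card - s₁)) I₂ = φ₂ (F₂ \ D₂) I₂'.card (I₂'.card + (min I₁.card s₁ + D₁.card - s₁)) I₂' :=
    eq_of_sdiff_sdiff_eq (y1.trans sdiff_subset) (z1.trans sdiff_subset) hDY hDY' e3
  have hlev : I₂'.card = I₂.card := by
    have := congrArg Finset.card hYeq
    rw [y2, z2] at this
    omega
  rw [hlev] at hYeq mem'
  have hH := hφ₂ (F₂ \ D₂) I₂.card (I₂.card + (min I₁.card s₁ + D₁.card - s₁)) (by omega) hall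
  have fp : I₂ = I₂' := hH.1 (mem_coe.2 mem) (mem_coe.2 mem') hYeq
  rw [fp]

/-- **L₂ vs L₂**: equal L-images on flat 2 come from equal sources (the overflowing flat decodes
directly, the partner through the injectivity of the absorber on its level). -/
theorem L₂_eq_L₂ (F₁ : Finset α) (F₂ : Finset β) (s₁ s₂ : ℕ) (J₁ : Finset α → Finset α) (J₂ : Finset β → Finset β)
    (hJ₁ : ∀ X, J₁ X ⊆ X) (hJ₂ : ∀ X, J₂ X ⊆ X) (lo hi δ : ℕ)
    (RS : Finset ((Finset α × Finset α) × (Finset β × Finset β)))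
    (hRS : ∀ σ : (Finset α × Finset α) × (Finset β × Finset β), σ ∈ RS ↔ σ.1.1 ⊆ F₁ ∧ σ.2.1 ⊆ F₂ ∧
      σ.1.2 ⊆ J₁ (F₁ \ σ.1.1) ∧ σ.2.2 ⊆ J₂ (F₂ \ σ.2.1) ∧
      σ.1.2.card + σ.2.2.card = δ ∧ lo ≤ min σ.1.1.card s₁ + min σ.2.1.card s₂ ∧
      min σ.1.1.card s₁ + min σ.2.1.card s₂ ≤ hi ∧
      hi + δ + 1 ≤ min (F₁.card - σ.1.1.card) s₁ + min (F₂.card - σ.2.1.card) s₂)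
    (φ₁ : Finset α → ℕ → ℕ → Finset α → Finset α)
    (hφ₁ : ∀ (S : Finset α) (i j : ℕ), i ≤ j → i + j ≤ S.card →
      (Set.InjOn (φ₁ S i j) (S.powersetCard i) ∧ ∀ I ∈ S.powersetCard i, φ₁ S i j I ∈ S.powersetCard j ∧ I ⊆ φ₁ S i j I))
    (σ τ : (Finset α × Finset α) × (Finset β × Finset β)) (hσ : σ ∈ RS) (hτ : τ ∈ RS)
    (s1 : s₂ < min σ.2.1.card s₂ + σ.2.2.card) (t1 : s₂ < min τ.2.1.card s₂ + τ.2.2.card) (h : (((F₁ \ (φ₁ (F₁ \ σ.1.2) σ.1.1.card (σ.1.1.card + (min σ.2.1.card s₂ + σ.2.2.card - s₂)) σ.1.1)) \ σ.1.2, σ.1.2), ((F₂ \ σ.2.1) \ σ.2.2, σ.2.2)) = (((F₁ \ (φ₁ (F₁ \ τ.1.2) τ.1.1.card (τ.1.1.card + (min τ.2.1.card s₂ + τ.2.2.card - s₂)) τ.1.1)) \ τ.1.2, τ.1.2), ((F₂ \ τ.2.1) \ τ.2.2, τ.2.2))) : σ = τ := by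
  obtain ⟨y1, y2, y3, hall, mem⟩ := absorb_L₂ F₁ F₂ s₁ s₂ J₁ J₂ hJ₁ lo hi δ RS hRS φ₁ hφ₁ σ hσ s1
  obtain ⟨z1, z2, z3, -, mem'⟩ := absorb_L₂ F₁ F₂ s₁ s₂ J₁ J₂ hJ₁ lo hi δ RS hRS φ₁ hφ₁ τ hτ t1
  obtain ⟨⟨I₁, D₁⟩, ⟨I₂, D₂⟩⟩ := σ
  obtain ⟨⟨I₁', D₁'⟩, ⟨I₂', D₂'⟩⟩ := τ
  simp only [Prod.mk.injEq] at h
  obtain ⟨⟨e1, e2⟩, ⟨e3, e4⟩⟩ := h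
  subst e2; subst e4
  obtain ⟨sI₁, sI₂, sD₁, sD₂, sδ, slo, shi, sf⟩ := (hRS _).1 hσ
  obtain ⟨tI₁, tI₂, tD₁, tD₂, tδ, tlo, thi, tf⟩ := (hRS _).1 hτ
  dsimp only at sI₁ sI₂ sD₁ sD₂ sδ slo shi sf tI₁ tI₂ tD₁ tD₂ tδ tlo thi tf s1 t1 e1 e3
  dsimp only at y1 y2 y3 hall mem z1 z2 z3 mem'
  -- flat 2 decodes directly
  have f2 : I₂ = I₂' := eq_of_sdiff_sdiff_eq sI₂ tI₂ (sD₂.trans (hJ₂ _)) (tD₂.trans (hJ₂ _)) e3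
  subst f2
  have hDY : D₁ ⊆ F₁ \ φ₁ (F₁ \ D₁) I₁.card (I₁.card + (min I₂.card s₂ + D₂.card - s₂)) I₁ := by
    intro d hd
    rw [mem_sdiff]
    exact ⟨(mem_sdiff.1 (sD₁.trans (hJ₁ _) hd)).1, fun hdY => (mem_sdiff.1 (y1 hdY)).2 hd⟩
  have hDY' : D₁ ⊆ F₁ \ φ₁ (F₁ \ D₁) I₁'.card (I₁'.card + (min I₂.card s₂ + D₂.card - s₂)) I₁' := by
    intro d hd
    rw [mem_sdiff]
    exact ⟨(mem_sdiff.1 (sD₁.trans (hJ₁ _) hd)).1, fun hdY => (mem_sdiff.1 (z1 hdY)).2 hd⟩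
  have hYeq : φ₁ (F₁ \ D₁) I₁.card (I₁.card + (min I₂.card s₂ + D₂.card - s₂)) I₁ = φ₁ (F₁ \ D₁) I₁'.card (I₁'.card + (min I₂.card s₂ + D₂.card - s₂)) I₁' :=
    eq_of_sdiff_sdiff_eq (y1.trans sdiff_subset) (z1.trans sdiff_subset) hDY hDY' e1
  have hlev : I₁'.card = I₁.card := by
    have := congrArg Finset.card hYeq
    rw [y2, z2] at this
    omega
  rw [hlev] at hYeq mem'
  have hH := hφ₁ (F₁ \ D₁) I₁.card (I₁.card + (min I₂.card s₂ + D₂.card - s₂)) (by omega) hall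
  have fp : I₁ = I₁' := hH.1 (mem_coe.2 mem) (mem_coe.2 mem') hYeq
  rw [fp]


end TwoFlatPLD

end PercRepro
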